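import Mathlib
import Literature.Probability.Percolation.PositiveAssociation
import HarnessLib

/-!
# Loewner association: positive association of matrix-valued fields in the Loewner order

Topic `Probability/LatticeModels` (definition item `defn-IsLoewnerAssociated`, request D3 of route
`Summit.QuantumFields.QCD.Theses.GluonFreeDual`; its crux DualPositiveAssociation is stated over it).

A configuration is a family `Q : ι → Matrix m n 𝕜` (`RCLike 𝕜`; in the route `ι` finite, `m = n = Fin 3`,
`𝕜 = ℂ`). The **Gram–Loewner preorder** is `Q ≼ Q' :⟺ ∀ p, Q'_p Q'_p† - Q_p Q_p† ⪰ 0` (Loewner order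
[HornJohnson2013, Def. 7.7.1] on the Gram data; Mathlib's scoped `MatrixOrder`). `F` is
**Loewner-monotone** ("non-decreasing in each `Q_p Q_p†`") if `Q ≼ Q' → F Q ≤ F Q'`. A finite measure
`μ` is **Loewner associated** if `(∫ F dμ)(∫ G dμ) ≤ μ(univ) ∫ F G dμ` for all bounded measurable
Loewner-monotone real `F, G` — for a probability measure, `∫ F G ≥ ∫ F ∫ G`: `μ` has positive
correlations in the sense of [Liggett2005, Ch. II Def. 2.11] (= positive association / FKG property,
[FortuinKasteleynGinibreCMP1971, (1.4), Prop. 1]; Esary–Proschan–Walkup 1967) for the Gram–Loewner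
preorder. The factor `μ(univ)` (FKG's normalised averages) makes the property invariant under
`μ ↦ c • μ` (`smul_measure`), so it may be asserted of an unnormalised dual weight.

## Contents (everything stated is proved)

* `GramLoewnerLE`, `gramLoewnerPreorder` (reducible `def`, NOT an instance), `IsLoewnerMonotone`
  (truncations, indicators); `isLoewnerMonotone_re_trace`: `Q ↦ Re tr Q_pQ_p† = Σ|Q_p i j|²` is
  monotone [HornJohnson2013, Cor. 7.7.4(d)].
* `IsLoewnerAssociated μ`; `IsLoewnerAssociatedOn 𝒞 μ` for a sub-cone `𝒞` of test functionals (e.g.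
  those measurable for a sub-σ-algebra). API asked for by the item: point masses are associated
  (`isLoewnerAssociated_dirac`); non-decreasing measurable images preserve association (`map`); pair
  covariances `Cov(f(‖Q_p‖²), g(‖Q_q‖²)) ≥ 0` (`covariance_comp_re_trace_nonneg`); increasing events
  are positively correlated (`measureReal_mul_le`), whence the bridges to the tree's classical FKG
  predicate `Literature.Probability.Percolation.IsPositivelyAssociated` — for `≼` itself
  (`isPositivelyAssociated`) and for the law of the profile `(‖Q_p‖²)_p ∈ ι → ℝ`, coordinatewise order
  (`isPositivelyAssociated_map_re_trace`).
* `N = 1` (`Subsingleton m`: `Q_p` a row vector `x_p`, `Q_pQ_p† = |x_p|²`): `≼` IS the coordinatewise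
  order of `(|x_p|²)_p` (`gramLoewnerLE_iff_re_trace_le_of_subsingleton`); with one index it is total
  and EVERY finite measure is Loewner associated (`isLoewnerAssociated_of_subsingleton`, Liggett's
  remark after Def. II.2.11, via Chebyshev's integral inequality) — a non-trivial inhabitant.

Design: Mathlib has no `MeasurableSpace (Matrix m n 𝕜)` instance, so the measure-theoretic part takes
`[MeasurableSpace (Matrix m n 𝕜)]` (+ `OpensMeasurableSpace` where continuity is used) as parameter.
Not here: a lattice/Holley criterion (the PSD cone is not a lattice); which measures are associated;
unbounded `L²` test functionals (use the truncation lemmas).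
-/

noncomputable section

open MeasureTheory Matrix Set
open scoped ComplexOrder MatrixOrder ENNReal ProbabilityTheory

namespace Literature.Probability.LatticeModels

variable {ι m n 𝕜 : Type*} [Fintype n] [RCLike 𝕜]

section Order

/-- **Gram–Loewner domination** `Q ≼ Q'`: for every index `p`, `Q'_p Q'_p† - Q_p Q_p†` is positive
semidefinite (the Loewner order [HornJohnson2013, Def. 7.7.1] on the Gram data). [cite: HornJohnson2013, Def. 7.7.1] -/
def GramLoewnerLE (Q Q' : ι → Matrix m n 𝕜) : Prop :=
  ∀ p, (Q' p * (Q' p)ᴴ - Q p * (Q p)ᴴ).PosSemidef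

/-- `Q ≼ Q'` iff `Q_p Q_p† ≤ Q'_p Q'_p†` for all `p` in Mathlib's Loewner order (`open scoped MatrixOrder`,
`Matrix.le_iff`). [cite: HornJohnson2013, Def. 7.7.1] -/
theorem gramLoewnerLE_iff_le {Q Q' : ι → Matrix m n 𝕜} :
    GramLoewnerLE Q Q' ↔ ∀ p, Q p * (Q p)ᴴ ≤ Q' p * (Q' p)ᴴ :=
  Iff.rfl

/-- Configurations with the same Gram data dominate each other. [folklore] -/
theorem GramLoewnerLE.of_gram_eq {Q Q' : ι → Matrix m n 𝕜} (h : ∀ p, Q p * (Q p)ᴴ = Q' p * (Q' p)ᴴ) :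
    GramLoewnerLE Q Q' := fun p => by
  rw [h p, sub_self]
  exact PosSemidef.zero

/-- `≼` is reflexive. [folklore] -/
protected theorem GramLoewnerLE.refl (Q : ι → Matrix m n 𝕜) : GramLoewnerLE Q Q :=
  GramLoewnerLE.of_gram_eq fun _ => rfl

/-- `≼` is transitive. [folklore] -/
protected theorem GramLoewnerLE.trans {Q₁ Q₂ Q₃ : ι → Matrix m n 𝕜} (h₁₂ : GramLoewnerLE Q₁ Q₂)
    (h₂₃ : GramLoewnerLE Q₂ Q₃) : GramLoewnerLE Q₁ Q₃ := fun p => by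
  simpa only [sub_add_sub_cancel] using (h₂₃ p).add (h₁₂ p)

variable (ι m n 𝕜) in
/-- The Gram–Loewner preorder as a `Preorder` structure (pull-back of the product Loewner order along
`Q ↦ (Q_p Q_p†)_p`); its `≤` is `GramLoewnerLE` by `Iff.rfl`. Deliberately NOT an instance. [cite: HornJohnson2013, Def. 7.7.1] -/
@[reducible] def gramLoewnerPreorder : Preorder (ι → Matrix m n 𝕜) :=
  Preorder.lift fun (Q : ι → Matrix m n 𝕜) (p : ι) => Q p * (Q p)ᴴ

variable {β γ : Type*} [Preorder β] [Preorder γ]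

/-- `F` is **Loewner-monotone** (non-decreasing in each Gram matrix `Q_p Q_p†` for the Loewner order):
`Q ≼ Q' → F Q ≤ F Q'`; the class `ℳ` of [Liggett2005, Ch. II §2] for the Gram–Loewner preorder
(`@Monotone _ _ (gramLoewnerPreorder ι m n 𝕜) _ F` by `Iff.rfl`). [cite: Liggett2005, Ch. II §2 and Def. 2.11] -/
def IsLoewnerMonotone (F : (ι → Matrix m n 𝕜) → β) : Prop :=
  ∀ ⦃Q Q' : ι → Matrix m n 𝕜⦄, GramLoewnerLE Q Q' → F Q ≤ F Q'

namespace IsLoewnerMonotone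

/-- Post-composition with a monotone map preserves Loewner-monotonicity. [folklore] -/
theorem comp_monotone {F : (ι → Matrix m n 𝕜) → β} (hF : IsLoewnerMonotone F) {φ : β → γ}
    (hφ : Monotone φ) : IsLoewnerMonotone (φ ∘ F) :=
  fun _ _ h => hφ (hF h)

/-- A Loewner-monotone map into a partial order only sees the Gram data `(Q_p Q_p†)_p`. [folklore] -/
theorem eq_of_gram_eq {δ : Type*} [PartialOrder δ] {F : (ι → Matrix m n 𝕜) → δ}
    (hF : IsLoewnerMonotone F) {Q Q' : ι → Matrix m n 𝕜} (h : ∀ p, Q p * (Q p)ᴴ = Q' p * (Q' p)ᴴ) :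
    F Q = F Q' :=
  le_antisymm (hF (.of_gram_eq h)) (hF (.of_gram_eq fun p => (h p).symm))

/-- Upper truncation `F ∧ c` stays Loewner-monotone (passage to bounded test functionals). [folklore] -/
theorem min_const {F : (ι → Matrix m n 𝕜) → ℝ} (hF : IsLoewnerMonotone F) (c : ℝ) :
    IsLoewnerMonotone fun Q => min (F Q) c :=
  fun _ _ h => min_le_min_right c (hF h)

/-- Lower truncation `F ∨ c` stays Loewner-monotone. [folklore] -/
theorem max_const {F : (ι → Matrix m n 𝕜) → ℝ} (hF : IsLoewnerMonotone F) (c : ℝ) :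
    IsLoewnerMonotone fun Q => max (F Q) c :=
  fun _ _ h => max_le_max_right c (hF h)

end IsLoewnerMonotone

/-- The indicator of a Loewner-increasing event (an upper set of `≼`) is Loewner-monotone. [folklore] -/
theorem isLoewnerMonotone_indicator_one {A : Set (ι → Matrix m n 𝕜)}
    (hA : ∀ ⦃Q Q'⦄, GramLoewnerLE Q Q' → Q ∈ A → Q' ∈ A) :
    IsLoewnerMonotone (A.indicator (1 : (ι → Matrix m n 𝕜) → ℝ)) := by
  intro Q Q' hQQ'
  by_cases hQ : Q ∈ A
  · simp [indicator_of_mem hQ, indicator_of_mem (hA hQQ' hQ)]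
  · rw [indicator_of_notMem hQ]
    exact indicator_nonneg (fun _ _ => zero_le_one) _

variable [Fintype m]

/-- **The trace is Loewner-monotone**: `A ⪯ B ⟹ Re tr A ≤ Re tr B`. [cite: HornJohnson2013, Cor. 7.7.4(d)] -/
theorem re_trace_le_of_posSemidef_sub {A B : Matrix m m 𝕜} (h : (B - A).PosSemidef) :
    RCLike.re A.trace ≤ RCLike.re B.trace := by
  have h1 := (RCLike.nonneg_iff.mp h.trace_nonneg).1
  rw [trace_sub, map_sub] at h1
  linarith

/-- `Re tr (A A†) = Σ_{i,j} |A i j|²`, the squared Frobenius norm (the route's `‖Q̃_p‖²`). [folklore] -/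
theorem re_trace_mul_conjTranspose_self (A : Matrix m n 𝕜) :
    RCLike.re (A * Aᴴ).trace = ∑ i, ∑ j, ‖A i j‖ ^ 2 := by
  simp only [Matrix.trace, Matrix.diag, Matrix.mul_apply, Matrix.conjTranspose_apply, map_sum]
  refine Finset.sum_congr rfl fun i _ => Finset.sum_congr rfl fun j _ => ?_
  rw [RCLike.star_def, RCLike.mul_conj]
  norm_cast

/-- **`Q ↦ Re tr (Q_p Q_p†) = ‖Q_p‖²` is Loewner-monotone** for every `p`. [cite: HornJohnson2013, Cor. 7.7.4(d)] -/
theorem isLoewnerMonotone_re_trace (p : ι) :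
    IsLoewnerMonotone fun Q : ι → Matrix m n 𝕜 => RCLike.re (Q p * (Q p)ᴴ).trace :=
  fun _ _ h => re_trace_le_of_posSemidef_sub (h p)

/-- `M ↦ Re tr (M M†)` is continuous (a polynomial in the entries). [folklore] -/
theorem continuous_re_trace_mul_conjTranspose_self :
    Continuous fun M : Matrix m n 𝕜 => RCLike.re (M * Mᴴ).trace :=
  RCLike.continuous_re.comp (continuous_id.matrix_mul continuous_id.matrix_conjTranspose).matrix_trace

/-- `N = 1`: over a row index type with at most one element, a Hermitian matrix is positive
semidefinite iff its (real) trace is `≥ 0`. [folklore] -/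
theorem posSemidef_iff_re_trace_nonneg_of_subsingleton [Subsingleton m] {D : Matrix m m 𝕜}
    (hD : D.IsHermitian) : D.PosSemidef ↔ 0 ≤ RCLike.re D.trace := by
  classical
  refine ⟨fun h => (RCLike.nonneg_iff.mp h.trace_nonneg).1, fun h0 => ?_⟩
  rcases isEmpty_or_nonempty m with hm | ⟨⟨i₀⟩⟩
  · rw [Subsingleton.elim D 0]
    exact PosSemidef.zero
  · have hdiag : D = Matrix.diagonal fun i => D i i := by
      ext i j
      rw [Subsingleton.elim j i, diagonal_apply_eq]
    have htr : D.trace = D i₀ i₀ := Fintype.sum_subsingleton _ i₀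
    have him : RCLike.im (D i₀ i₀) = 0 := by
      have h := hD.apply i₀ i₀
      rw [RCLike.star_def] at h
      exact RCLike.conj_eq_iff_im.mp h
    rw [hdiag, posSemidef_diagonal_iff]
    intro i
    rw [Subsingleton.elim i i₀]
    exact RCLike.nonneg_iff.mpr ⟨by rwa [htr] at h0, him⟩

/-- **`N = 1`: the Gram–Loewner preorder is the coordinatewise order of `(|x_p|²)_p`** — for row
vectors `Q_p = x_p`, `Q ≼ Q' ↔ ∀ p, |x_p|² ≤ |x'_p|²` (`Q_p Q_p† = |x_p|²`); the dictionary to the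
classical FKG setting `ι → ℝ`. [folklore] -/
theorem gramLoewnerLE_iff_re_trace_le_of_subsingleton [Subsingleton m] {Q Q' : ι → Matrix m n 𝕜} :
    GramLoewnerLE Q Q' ↔
      ∀ p, RCLike.re (Q p * (Q p)ᴴ).trace ≤ RCLike.re (Q' p * (Q' p)ᴴ).trace := by
  refine forall_congr' fun p => ?_
  rw [posSemidef_iff_re_trace_nonneg_of_subsingleton ((posSemidef_self_mul_conjTranspose _).isHermitian.sub
    (posSemidef_self_mul_conjTranspose _).isHermitian), trace_sub, map_sub, sub_nonneg]

/-- With at most one index and `N = 1` the Gram–Loewner preorder is **total**. [folklore] -/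
theorem gramLoewnerLE_total [Subsingleton ι] [Subsingleton m] (Q Q' : ι → Matrix m n 𝕜) :
    GramLoewnerLE Q Q' ∨ GramLoewnerLE Q' Q := by
  simp only [gramLoewnerLE_iff_re_trace_le_of_subsingleton]
  rcases isEmpty_or_nonempty ι with hι | ⟨⟨p₀⟩⟩
  · exact Or.inl fun p => isEmptyElim p
  · rcases le_total (RCLike.re (Q p₀ * (Q p₀)ᴴ).trace) (RCLike.re (Q' p₀ * (Q' p₀)ᴴ).trace) with h | h
    · exact Or.inl fun p => by obtain rfl : p = p₀ := Subsingleton.elim _ _; exact h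
    · exact Or.inr fun p => by obtain rfl : p = p₀ := Subsingleton.elim _ _; exact h

end Order

/-- **Chebyshev's integral inequality**: on a finite measure space, if `f, g, f g` are integrable and
`f, g` are similarly ordered, `(f ω - f ω')(g ω - g ω') ≥ 0`, then `(∫ f)(∫ g) ≤ μ(univ) ∫ f g`
(integrate the non-negative function `(f ω - f ω')(g ω - g ω')` in both variables; the computation
behind "if `X` is linearly ordered, then any `μ` has positive correlations"). [cite: Liggett2005, Ch. II §2, remark after Def. 2.11] -/
theorem integral_mul_integral_le_of_forall_mul_sub_nonneg {Ω : Type*} [MeasurableSpace Ω]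
    {μ : Measure Ω} [IsFiniteMeasure μ] {f g : Ω → ℝ} (hf : Integrable f μ) (hg : Integrable g μ)
    (hfg : Integrable (fun ω => f ω * g ω) μ) (h : ∀ ω ω', 0 ≤ (f ω - f ω') * (g ω - g ω')) :
    (∫ ω, f ω ∂μ) * (∫ ω, g ω ∂μ) ≤ μ.real univ * ∫ ω, f ω * g ω ∂μ := by
  set A := ∫ ω, f ω ∂μ
  set B := ∫ ω, g ω ∂μ
  set D := ∫ ω, f ω * g ω ∂μ
  set c := μ.real univ
  have hinner : ∀ ω, ∫ ω', (f ω - f ω') * (g ω - g ω') ∂μ = c * (f ω * g ω) - f ω * B - g ω * A + D := by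
    intro ω
    have h12 : Integrable (fun ω' => f ω * g ω - f ω * g ω') μ := (integrable_const _).sub (hg.const_mul _)
    have h123 : Integrable (fun ω' => f ω * g ω - f ω * g ω' - g ω * f ω') μ := h12.sub (hf.const_mul _)
    rw [show (fun ω' => (f ω - f ω') * (g ω - g ω')) =
        fun ω' => f ω * g ω - f ω * g ω' - g ω * f ω' + f ω' * g ω' from funext fun _ => by ring,
      integral_add h123 hfg, integral_sub h12 (hf.const_mul _),
      integral_sub (integrable_const _) (hg.const_mul _), integral_const, integral_const_mul,
      integral_const_mul, smul_eq_mul]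
  have h12' : Integrable (fun ω => c * (f ω * g ω) - f ω * B) μ := (hfg.const_mul _).sub (hf.mul_const _)
  have h123' : Integrable (fun ω => c * (f ω * g ω) - f ω * B - g ω * A) μ := h12'.sub (hg.mul_const _)
  have houter : ∫ ω, (c * (f ω * g ω) - f ω * B - g ω * A + D) ∂μ = 2 * (c * D - A * B) := by
    rw [integral_add h123' (integrable_const _), integral_sub h12' (hg.mul_const _),
      integral_sub (hfg.const_mul _) (hf.mul_const _), integral_const_mul, integral_mul_const,
      integral_mul_const, integral_const, smul_eq_mul]
    ring
  have hnonneg : 0 ≤ ∫ ω, ∫ ω', (f ω - f ω') * (g ω - g ω') ∂μ ∂μ :=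
    integral_nonneg fun ω => integral_nonneg fun ω' => h ω ω'
  rw [show (fun ω => ∫ ω', (f ω - f ω') * (g ω - g ω') ∂μ) =
      fun ω => c * (f ω * g ω) - f ω * B - g ω * A + D from funext hinner, houter] at hnonneg
  linarith

/-- A bounded measurable real function is integrable against a finite measure. [folklore] -/
theorem integrable_of_measurable_of_abs_le {Ω : Type*} [MeasurableSpace Ω] {μ : Measure Ω}
    [IsFiniteMeasure μ] {F : Ω → ℝ} (hFm : Measurable F) {C : ℝ} (hC : ∀ ω, |F ω| ≤ C) :
    Integrable F μ :=
  .of_bound hFm.aestronglyMeasurable C (ae_of_all _ fun ω => (Real.norm_eq_abs _).le.trans (hC ω))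

section Measure

variable [MeasurableSpace (Matrix m n 𝕜)]

/-- **Loewner association** of a (finite) measure `μ` on configurations `ι → Matrix m n 𝕜`: positive
association with respect to bounded measurable functionals non-decreasing in each Gram matrix
`Q_p Q_p†` (Loewner order) — `(∫ F dμ)(∫ G dμ) ≤ μ(univ) ∫ F G dμ` for all such `F, G`. For a
probability measure: `∫ F G dμ ≥ ∫ F dμ ∫ G dμ`, positive correlations in the sense of
[Liggett2005, Ch. II Def. 2.11] (the FKG property [FortuinKasteleynGinibreCMP1971, (1.4)]) for the
Gram–Loewner preorder; the factor `μ(univ)` is FKG's normalisation. [cite: Liggett2005, Ch. II Def. 2.11] -/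
def IsLoewnerAssociated (μ : Measure (ι → Matrix m n 𝕜)) : Prop :=
  ∀ ⦃F G : (ι → Matrix m n 𝕜) → ℝ⦄, IsLoewnerMonotone F → IsLoewnerMonotone G →
    Measurable F → Measurable G → (∃ C, ∀ Q, |F Q| ≤ C) → (∃ C, ∀ Q, |G Q| ≤ C) →
      (∫ Q, F Q ∂μ) * (∫ Q, G Q ∂μ) ≤ μ.real univ * ∫ Q, F Q * G Q ∂μ

/-- **Loewner association on a cone** `𝒞` of test functionals (e.g. those measurable for a
sub-σ-algebra, or functions of finitely many `Q_p Q_p†`): the same inequality, asked only of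
`F, G ∈ 𝒞`. `IsLoewnerAssociated μ ↔ IsLoewnerAssociatedOn univ μ`. [cite: Liggett2005, Ch. II Def. 2.11] -/
def IsLoewnerAssociatedOn (𝒞 : Set ((ι → Matrix m n 𝕜) → ℝ)) (μ : Measure (ι → Matrix m n 𝕜)) : Prop :=
  ∀ ⦃F G : (ι → Matrix m n 𝕜) → ℝ⦄, F ∈ 𝒞 → G ∈ 𝒞 → IsLoewnerMonotone F → IsLoewnerMonotone G →
    Measurable F → Measurable G → (∃ C, ∀ Q, |F Q| ≤ C) → (∃ C, ∀ Q, |G Q| ≤ C) →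
      (∫ Q, F Q ∂μ) * (∫ Q, G Q ∂μ) ≤ μ.real univ * ∫ Q, F Q * G Q ∂μ

/-- Association on the full cone is Loewner association. [folklore] -/
theorem isLoewnerAssociatedOn_univ {μ : Measure (ι → Matrix m n 𝕜)} :
    IsLoewnerAssociatedOn univ μ ↔ IsLoewnerAssociated μ :=
  ⟨fun h _ _ => h (mem_univ _) (mem_univ _), fun h _ _ _ _ => @h _ _⟩

/-- **Point masses are Loewner associated** ("the pointmass `δ_η` has positive correlations").
[cite: Liggett2005, Ch. II §2, proof of Thm. 2.14] -/
theorem isLoewnerAssociated_dirac (Q₀ : ι → Matrix m n 𝕜) :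
    IsLoewnerAssociated (Measure.dirac Q₀) := by
  intro F G _ _ hFm hGm _ _
  have h3 : ∫ Q, F Q * G Q ∂(Measure.dirac Q₀) = F Q₀ * G Q₀ :=
    integral_dirac' (fun Q => F Q * G Q) Q₀ (hFm.fun_mul hGm).stronglyMeasurable
  rw [integral_dirac' _ _ hFm.stronglyMeasurable, integral_dirac' _ _ hGm.stronglyMeasurable, h3,
    probReal_univ, one_mul]

/-- **One index, `N = 1`: every finite measure is Loewner associated** (the law of a single vector
`x ∈ 𝕜ⁿ`, functionals non-decreasing in `|x|²`): `≼` is total (`gramLoewnerLE_total`), so monotone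
`F, G` are similarly ordered and Chebyshev's inequality applies — "if `X` is linearly ordered, then
any `μ` has positive correlations". [cite: Liggett2005, Ch. II §2, remark after Def. 2.11] -/
theorem isLoewnerAssociated_of_subsingleton [Fintype m] [Subsingleton ι] [Subsingleton m]
    (μ : Measure (ι → Matrix m n 𝕜)) [IsFiniteMeasure μ] : IsLoewnerAssociated μ := by
  rintro F G hF hG hFm hGm ⟨CF, hCF⟩ ⟨CG, hCG⟩
  have hFGi : Integrable (fun Q => F Q * G Q) μ := by
    refine integrable_of_measurable_of_abs_le (hFm.fun_mul hGm) (C := CF * CG) fun Q => ?_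
    rw [abs_mul]
    exact mul_le_mul (hCF Q) (hCG Q) (abs_nonneg _) ((abs_nonneg _).trans (hCF Q))
  refine integral_mul_integral_le_of_forall_mul_sub_nonneg (integrable_of_measurable_of_abs_le hFm hCF)
    (integrable_of_measurable_of_abs_le hGm hCG) hFGi fun Q Q' => ?_
  rcases gramLoewnerLE_total Q Q' with h | h
  · exact mul_nonneg_of_nonpos_of_nonpos (sub_nonpos.2 (hF h)) (sub_nonpos.2 (hG h))
  · exact mul_nonneg (sub_nonneg.2 (hF h)) (sub_nonneg.2 (hG h))

/-- `Q ↦ Re tr (Q_p Q_p†)` is measurable (Borel-compatible structure on the matrix factor). [folklore] -/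
theorem measurable_re_trace_gram [Fintype m] [OpensMeasurableSpace (Matrix m n 𝕜)] (p : ι) :
    Measurable fun Q : ι → Matrix m n 𝕜 => RCLike.re (Q p * (Q p)ᴴ).trace :=
  continuous_re_trace_mul_conjTranspose_self.measurable.comp (measurable_pi_apply p)

namespace IsLoewnerAssociated

variable {μ : Measure (ι → Matrix m n 𝕜)}

/-- **Probability form** (Liggett's Def. II.2.11 verbatim for the Gram–Loewner preorder):
`∫ F dμ ∫ G dμ ≤ ∫ F G dμ`. [cite: Liggett2005, Ch. II Def. 2.11] -/
theorem integral_mul_integral_le [IsProbabilityMeasure μ] (h : IsLoewnerAssociated μ)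
    {F G : (ι → Matrix m n 𝕜) → ℝ} (hF : IsLoewnerMonotone F) (hG : IsLoewnerMonotone G)
    (hFm : Measurable F) (hGm : Measurable G) (hFb : ∃ C, ∀ Q, |F Q| ≤ C)
    (hGb : ∃ C, ∀ Q, |G Q| ≤ C) : (∫ Q, F Q ∂μ) * (∫ Q, G Q ∂μ) ≤ ∫ Q, F Q * G Q ∂μ := by
  simpa only [probReal_univ, one_mul] using h hF hG hFm hGm hFb hGb

/-- For a probability measure, `IsLoewnerAssociated μ` is literally the requested / Liggett's
condition `∫ F G dμ ≥ ∫ F dμ ∫ G dμ` for all bounded measurable Loewner-monotone `F, G`. [cite: Liggett2005, Ch. II Def. 2.11] -/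
theorem _root_.Literature.Probability.LatticeModels.isLoewnerAssociated_iff [IsProbabilityMeasure μ] :
    IsLoewnerAssociated μ ↔ ∀ ⦃F G : (ι → Matrix m n 𝕜) → ℝ⦄, IsLoewnerMonotone F →
      IsLoewnerMonotone G → Measurable F → Measurable G → (∃ C, ∀ Q, |F Q| ≤ C) →
        (∃ C, ∀ Q, |G Q| ≤ C) → (∫ Q, F Q ∂μ) * (∫ Q, G Q ∂μ) ≤ ∫ Q, F Q * G Q ∂μ := by
  simp only [IsLoewnerAssociated, probReal_univ, one_mul]

/-- **Covariance form** `Cov_μ(F, G) ≥ 0` (Mathlib's `ProbabilityTheory.covariance`), the shape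
`⟨fg⟩ - ⟨f⟩⟨g⟩ ≥ 0` of [FortuinKasteleynGinibreCMP1971, (2.2)]. [cite: FortuinKasteleynGinibreCMP1971, Prop. 1 (2.2)] -/
theorem covariance_nonneg [IsProbabilityMeasure μ] (h : IsLoewnerAssociated μ)
    {F G : (ι → Matrix m n 𝕜) → ℝ} (hF : IsLoewnerMonotone F) (hG : IsLoewnerMonotone G)
    (hFm : Measurable F) (hGm : Measurable G) (hFb : ∃ C, ∀ Q, |F Q| ≤ C)
    (hGb : ∃ C, ∀ Q, |G Q| ≤ C) : 0 ≤ cov[F, G; μ] := by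
  obtain ⟨CF, hCF⟩ := hFb
  obtain ⟨CG, hCG⟩ := hGb
  have hF2 : MemLp F 2 μ := .of_bound hFm.aestronglyMeasurable CF
    (ae_of_all _ fun Q => (Real.norm_eq_abs _).le.trans (hCF Q))
  have hG2 : MemLp G 2 μ := .of_bound hGm.aestronglyMeasurable CG
    (ae_of_all _ fun Q => (Real.norm_eq_abs _).le.trans (hCG Q))
  rw [ProbabilityTheory.covariance_eq_sub hF2 hG2, sub_nonneg]
  simpa only [Pi.mul_apply] using h.integral_mul_integral_le hF hG hFm hGm ⟨CF, hCF⟩ ⟨CG, hCG⟩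

/-- **Homogeneity**: `μ ↦ c • μ` preserves Loewner association (`c = ∞` included), so an
unnormalised finite weight is Loewner associated iff its normalisation is. [folklore] -/
theorem smul_measure (h : IsLoewnerAssociated μ) (c : ℝ≥0∞) : IsLoewnerAssociated (c • μ) := by
  intro F G hF hG hFm hGm hFb hGb
  have h0 := h hF hG hFm hGm hFb hGb
  simp only [integral_smul_measure, measureReal_ennreal_smul_apply, smul_eq_mul]
  calc c.toReal * (∫ Q, F Q ∂μ) * (c.toReal * ∫ Q, G Q ∂μ)
      = (c.toReal * c.toReal) * ((∫ Q, F Q ∂μ) * ∫ Q, G Q ∂μ) := by ring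
    _ ≤ (c.toReal * c.toReal) * (μ.real univ * ∫ Q, F Q * G Q ∂μ) :=
        mul_le_mul_of_nonneg_left h0 (mul_self_nonneg _)
    _ = c.toReal * μ.real univ * (c.toReal * ∫ Q, F Q * G Q ∂μ) := by ring

/-- **Non-decreasing measurable images preserve Loewner association**: if `T` maps configurations to
configurations (possibly other index/shape/scalars) with `Q ≼ Q' → T Q ≼ T Q'`, then `μ.map T` is
Loewner associated when `μ` is ("non-decreasing functions of associated variables are associated",
Esary–Proschan–Walkup). [folklore] -/
theorem map {ι' m' n' 𝕜' : Type*} [Fintype n'] [RCLike 𝕜'] [MeasurableSpace (Matrix m' n' 𝕜')]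
    (h : IsLoewnerAssociated μ)
    {T : (ι → Matrix m n 𝕜) → ι' → Matrix m' n' 𝕜'}
    (hT : ∀ ⦃Q Q'⦄, GramLoewnerLE Q Q' → GramLoewnerLE (T Q) (T Q')) (hTm : Measurable T) :
    IsLoewnerAssociated (μ.map T) := by
  intro F G hF hG hFm hGm hFb hGb
  rw [integral_map hTm.aemeasurable hFm.aestronglyMeasurable,
    integral_map hTm.aemeasurable hGm.aestronglyMeasurable,
    integral_map hTm.aemeasurable (hFm.fun_mul hGm).aestronglyMeasurable,
    map_measureReal_apply hTm MeasurableSet.univ, preimage_univ]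
  exact h (fun Q Q' hQQ' => hF (hT hQQ')) (fun Q Q' hQQ' => hG (hT hQQ')) (hFm.comp hTm)
    (hGm.comp hTm) (hFb.imp fun C hC Q => hC (T Q)) (hGb.imp fun C hC Q => hC (T Q))

/-- **Pair covariances of monotone functions of `‖Q_p‖²` are non-negative**:
`Cov(f(Re tr Q_pQ_p†), g(Re tr Q_qQ_q†)) ≥ 0` for bounded measurable non-decreasing `f, g : ℝ → ℝ`
(the dictionary Griffiths II ↦ plaquette covariances of route GluonFreeDual). [cite: Liggett2005, Ch. II Def. 2.11] -/
theorem covariance_comp_re_trace_nonneg [Fintype m] [OpensMeasurableSpace (Matrix m n 𝕜)]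
    [IsProbabilityMeasure μ] (h : IsLoewnerAssociated μ) {f g : ℝ → ℝ} (hf : Monotone f) (hg : Monotone g)
    (hfm : Measurable f) (hgm : Measurable g) (hfb : ∃ C, ∀ x, |f x| ≤ C)
    (hgb : ∃ C, ∀ x, |g x| ≤ C) (p q : ι) :
    0 ≤ cov[fun Q => f (RCLike.re (Q p * (Q p)ᴴ).trace),
      fun Q => g (RCLike.re (Q q * (Q q)ᴴ).trace); μ] :=
  h.covariance_nonneg ((isLoewnerMonotone_re_trace p).comp_monotone hf)
    ((isLoewnerMonotone_re_trace q).comp_monotone hg) (hfm.comp (measurable_re_trace_gram p))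
    (hgm.comp (measurable_re_trace_gram q)) (hfb.imp fun _ hC _ => hC _) (hgb.imp fun _ hC _ => hC _)

/-- **Loewner-increasing events are positively correlated**: for measurable upper sets `A, B` of
`≼`, `μ(A) μ(B) ≤ μ(univ) μ(A ∩ B)` (the definition applied to indicators). [cite: FortuinKasteleynGinibreCMP1971, §1 (1.4)] -/
theorem measureReal_mul_le [IsFiniteMeasure μ] (h : IsLoewnerAssociated μ)
    {A B : Set (ι → Matrix m n 𝕜)} (hA : ∀ ⦃Q Q'⦄, GramLoewnerLE Q Q' → Q ∈ A → Q' ∈ A)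
    (hB : ∀ ⦃Q Q'⦄, GramLoewnerLE Q Q' → Q ∈ B → Q' ∈ B) (hAm : MeasurableSet A)
    (hBm : MeasurableSet B) : μ.real A * μ.real B ≤ μ.real univ * μ.real (A ∩ B) := by
  have hbd : ∀ S : Set (ι → Matrix m n 𝕜), ∃ C : ℝ,
      ∀ Q, |S.indicator (1 : (ι → Matrix m n 𝕜) → ℝ) Q| ≤ C :=
    fun S => ⟨1, fun Q => by by_cases hQ : Q ∈ S <;> simp [hQ]⟩
  have key := h (isLoewnerMonotone_indicator_one hA) (isLoewnerMonotone_indicator_one hB)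
    (measurable_one.indicator hAm) (measurable_one.indicator hBm) (hbd A) (hbd B)
  have hprod : (fun Q => A.indicator (1 : (ι → Matrix m n 𝕜) → ℝ) Q *
      B.indicator (1 : (ι → Matrix m n 𝕜) → ℝ) Q) =
      fun Q => (A ∩ B).indicator (1 : (ι → Matrix m n 𝕜) → ℝ) Q := by
    funext Q
    by_cases hQA : Q ∈ A <;> by_cases hQB : Q ∈ B <;> simp [hQA, hQB]
  rwa [integral_indicator_one hAm, integral_indicator_one hBm, hprod,
    integral_indicator_one (hAm.inter hBm)] at key

/-- **Bridge I** to the tree's event-form FKG property: a Loewner-associated probability measure is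
`IsPositivelyAssociated` for the Gram–Loewner preorder `gramLoewnerPreorder`. [folklore] -/
theorem isPositivelyAssociated [IsProbabilityMeasure μ] (h : IsLoewnerAssociated μ) :
    @Literature.Probability.Percolation.IsPositivelyAssociated (ι → Matrix m n 𝕜) _
      (gramLoewnerPreorder ι m n 𝕜) μ :=
  @Literature.Probability.Percolation.isPositivelyAssociated_of_real _ _
    (gramLoewnerPreorder ι m n 𝕜) μ _ fun A B hA hB hAm hBm => by
      simpa only [probReal_univ, one_mul] using
        h.measureReal_mul_le (fun Q Q' hQQ' hQ => hA (a := Q) (b := Q') hQQ' hQ)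
          (fun Q Q' hQQ' hQ => hB (a := Q) (b := Q') hQQ' hQ) hAm hBm

/-- **Bridge II — the classical FKG setting `ι → ℝ`**: under a Loewner-associated probability measure
the law of the profile `(‖Q_p‖²)_p = (Re tr Q_pQ_p†)_p ∈ ι → ℝ` is positively associated for the
coordinatewise order (`IsPositivelyAssociated`, the Harris–FKG property of the tree's percolation /
Ising vocabulary); for `N = 1` this profile map is an order embedding
(`gramLoewnerLE_iff_re_trace_le_of_subsingleton`). [folklore] -/
theorem isPositivelyAssociated_map_re_trace [Fintype m] [OpensMeasurableSpace (Matrix m n 𝕜)]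
    [IsProbabilityMeasure μ] (h : IsLoewnerAssociated μ) :
    Literature.Probability.Percolation.IsPositivelyAssociated
      (μ.map fun (Q : ι → Matrix m n 𝕜) (p : ι) => RCLike.re (Q p * (Q p)ᴴ).trace) := by
  have hTm : Measurable fun (Q : ι → Matrix m n 𝕜) (p : ι) => RCLike.re (Q p * (Q p)ᴴ).trace :=
    measurable_pi_lambda _ fun p => measurable_re_trace_gram p
  haveI := Measure.isProbabilityMeasure_map (μ := μ) hTm.aemeasurable
  refine Literature.Probability.Percolation.isPositivelyAssociated_of_real fun A B hA hB hAm hBm => ?_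
  rw [map_measureReal_apply hTm hAm, map_measureReal_apply hTm hBm,
    map_measureReal_apply hTm (hAm.inter hBm), preimage_inter]
  simpa only [probReal_univ, one_mul] using
    h.measureReal_mul_le (A := _ ⁻¹' A) (B := _ ⁻¹' B)
      (fun Q Q' hQQ' hQ => hA (fun p => re_trace_le_of_posSemidef_sub (hQQ' p)) hQ)
      (fun Q Q' hQQ' hQ => hB (fun p => re_trace_le_of_posSemidef_sub (hQQ' p)) hQ) (hTm hAm) (hTm hBm)

end IsLoewnerAssociated

end Measure

end Literature.Probability.LatticeModels
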